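import Mathlib

/-!
# T5TwistPairs — the two twists of the endoscopic datum have different base change (CHECK-DATUM Δ1)

Kernel witness for route/T5-CHECK-DATUM-p6.md §5 Δ1 (cell pub-hodge-repro2, Tier 5).
At a split place the base change of the endoscopic representation `π₀ = Θ(β′)` is an unordered
pair of characters `{η₁, η₂}` with `η₂` independent of `β′` and `η₁ = β̃′⁻¹·(fixed)`.
Twisting `π₀` by `ν̃∘det` multiplies both by `ν`; replacing `β′` by `β′ν̃²` multiplies `η₁` by `ν⁻²`
and leaves `η₂` alone.  The two resulting pairs coincide only if `ν⁴ = 1`, hence only if `ν = 1`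
when `ν` has odd (e.g. `p`-power, `p` odd) order.  Characters form a commutative group, so this
is a statement about an arbitrary commutative group `G`.
-/

namespace Summit.Ventures.HodgeRepro2.T5TwistPairs

variable {G : Type*} [CommGroup G]

/-- If the unordered pairs `{a·n, b·n}` and `{a·n⁻¹·n⁻¹, b}` coincide (as multisets), then
`n ^ 4 = 1`: either the pairs match componentwise (then `b·n = b` forces `n = 1`) or crosswise
(then `b = a·n` and `a·n·n = a·n⁻¹·n⁻¹` force `n ^ 4 = 1`). -/
theorem pow_four_eq_one_of_pair_eq {a b n : G}
    (h : ({a * n, b * n} : Multiset G) = {a * n⁻¹ * n⁻¹, b}) : n ^ 4 = 1 := by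
  rcases Multiset.cons_eq_cons.mp h with ⟨_, h2⟩ | ⟨_, cs, h1, h2⟩
  · -- componentwise: `{b * n} = {b}`
    have hb : b * n = b := Multiset.singleton_inj.mp h2
    have hn : n = 1 := by
      have := mul_left_cancel (a := b) (hb.trans (mul_one b).symm)
      exact this
    simp [hn]
  · -- crosswise: `{b * n} = (a * n⁻¹ * n⁻¹) ::ₘ cs` and `{b} = (a * n) ::ₘ cs`
    obtain ⟨e1, -⟩ := (Multiset.singleton_eq_cons_iff cs).mp h1
    obtain ⟨e2, -⟩ := (Multiset.singleton_eq_cons_iff cs).mp h2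
    subst e2
    -- a * n * n = a * n⁻¹ * n⁻¹
    have h4 : n * n * (n * n) = 1 := by
      have h' : a * (n * n * (n * n)) = a * 1 := by
        calc a * (n * n * (n * n)) = (a * n * n) * (n * n) := by group
          _ = (a * n⁻¹ * n⁻¹) * (n * n) := by rw [e1]
          _ = a * 1 := by group
      exact mul_left_cancel h'
    calc n ^ 4 = n * n * (n * n) := by rw [show (4 : ℕ) = 2 + 2 from rfl, pow_add, pow_two]
      _ = 1 := h4

/-- A `4`-torsion element of odd (prime-power) order is trivial: if `n ^ 4 = 1` and
`n ^ (p ^ k) = 1` with `p` odd, then `n = 1`.  This is the `p odd` clause of Δ1 (3):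
`ν_w⁴ = 1` forces `ν_w = 1` for a character of `p`-power order. -/
theorem eq_one_of_pow_four_eq_one_of_pow_odd_eq_one {n : G} {m : ℕ} (hm : Odd m)
    (h4 : n ^ 4 = 1) (hmn : n ^ m = 1) : n = 1 := by
  have h1 : orderOf n ∣ 4 := orderOf_dvd_of_pow_eq_one h4
  have h2 : orderOf n ∣ m := orderOf_dvd_of_pow_eq_one hmn
  have hcop : Nat.Coprime 4 m := by
    have : Nat.Coprime 2 m := Nat.coprime_two_left.mpr hm
    simpa using Nat.Coprime.pow_left 2 this
  have : orderOf n = 1 := Nat.eq_one_of_dvd_coprimes hcop h1 h2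
  exact orderOf_eq_one_iff.mp this

/-- Combined statement used in CHECK-DATUM Δ1 (3): if the base-change pairs of `π₀ ⊗ (ν̃∘det)`
and of `Θ(β′ν̃²)` coincide at a split place and `ν_w` has odd order `m`, then `ν_w = 1`. -/
theorem eq_one_of_pair_eq_of_odd {a b n : G} {m : ℕ} (hm : Odd m) (hmn : n ^ m = 1)
    (h : ({a * n, b * n} : Multiset G) = {a * n⁻¹ * n⁻¹, b}) : n = 1 :=
  eq_one_of_pow_four_eq_one_of_pow_odd_eq_one hm (pow_four_eq_one_of_pair_eq h) hmn

/-- Conversely, for `n ≠ 1` the two pairs are distinct: the contrapositive of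
`eq_one_of_pair_eq_of_odd`, stated for the record. -/
theorem pair_ne_of_ne_one_of_odd {a b n : G} {m : ℕ} (hm : Odd m) (hmn : n ^ m = 1)
    (hn : n ≠ 1) : ({a * n, b * n} : Multiset G) ≠ {a * n⁻¹ * n⁻¹, b} :=
  fun h => hn (eq_one_of_pair_eq_of_odd hm hmn h)

end Summit.Ventures.HodgeRepro2.T5TwistPairs
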